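import Summits.ABC.ABC.Theses.FeketeScales
import Summits.ABC.ABC.Theses.FermatTwistHeights
import Summits.ABC.ABC.Theorems.FeketeScalesPolynomialAbcOfSubmult
import Summits.ABC.ABC.Theorems.FeketeScalesAssembly
import Literature.NumberTheory.DiophantineGeometry.AbcWave0SUnitProofs
import Literature.Barriers.ABC.BakerMethodBounds
import HarnessLib

/-!
# Route FeketeScales — crux `SparseGoodScales` (stmt-ABC-2161): the window factorisation

Helper file (`--supports stmt-ABC-2161`) for the crux `SparseGoodScales` of route `FeketeScales`
("abc along SOME unbounded sequence of radical scales": for every `δ > 0` there are arbitrarily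
large `R` with `c ≤ R^{1+δ}` for every abc triple of radical `≤ R`), line `Sketch` of
`Cruxes/SparseGoodScales/` (idea card `bounded-quality-times-radical-droughts`).  It lands the
kernel-checked VERTICAL × HORIZONTAL factorisation on which the line's skeleton
(`Cruxes/SparseGoodScales/Lines/Sketch.lean`) is built, all statements written inline in the
tree's vocabulary (`IsABCTriple`, `rad`, the route decls; no new definitions):

* BQ ("bounded quality", the vertical factor) is the sentence
  `∃ A C, ∀ abc triples, c ≤ C · rad^A` — verbatim the conclusion of the proved support item
  `PolynomialAbcOfSubmult` (stmt-ABC-2163);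
* WGS ("windowed good scales", the horizontal factor) is the sentence
  `∀ δ > 0, ∀ Λ > 1, ∀ N, ∃ R ≥ N, ∀ abc triples, rad ≤ R → R < rad^Λ → c ≤ R^{1+δ}` — the crux with
  the triples of radical `≤ R^{1/Λ}` deleted.

Results (all elementary real analysis):
* `sparseGoodScales_of_boundedQuality_of_windowed` : BQ → WGS → `SparseGoodScales` (height
  truncation by the window; this is the skeleton's composition);
* `sparseGoodScales_windowed_of_sparseGoodScales` : `SparseGoodScales` → WGS;
* `sparseGoodScales_iff_windowed_of_boundedQuality` : BQ → (`SparseGoodScales` ↔ WGS);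
* `sparseGoodScales_boundedQuality_of_scaleSubmultiplicativity` : the sister crux
  `ScaleSubmultiplicativity` (stmt-ABC-2160) gives BQ, by `polynomialAbcOfSubmult_proof` and the
  discharged abc.S25 `finite_setOf_isABCTriple_primeFactors_subset_holds` — the in-route supply of
  the vertical stub;
* `sparseGoodScales_iff_windowed_of_scaleSubmultiplicativity` : inside the route the crux is
  EQUIVALENT to its windowed, height-free form;
* `sparseGoodScales_of_abc` : calibration `ABC → SparseGoodScales` (every large scale is good).

What is NOT here: any proof of BQ or of WGS (both open; see the line card and
`Cruxes/SparseGoodScales/BarrierNotes-r1-k2.md`, N3–N5).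
-/

-- `Summit.<Summit>.<Problem>` is the mandated summit-side namespace (CONVENTIONS §2); for the
-- single-conjunct summit `ABC` the two coincide, so the duplicate `ABC.ABC` is deliberate.
set_option linter.dupNamespace false

namespace Summit.ABC.ABC.Theorems

open Literature.NumberTheory.DiophantineGeometry
open Summit.ABC.ABC.Theses.FeketeScales

/-- **Height truncation by the window (the composition of line `Sketch`).**  Bounded quality
(`c ≤ C·rad^A` for all abc triples) and windowed good scales (for every `δ > 0`, `Λ > 1`, `N` a
scale `R ≥ N` at which every abc triple with `rad ≤ R < rad^Λ` has `c ≤ R^{1+δ}`) imply the crux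
`SparseGoodScales`.  Proof: with `A' = max A 1`, `C' = max C 1`, `Λ = 2A'` and a windowed-good
scale `R ≥ C'^2`, a triple with `rad^Λ ≤ R` has
`c ≤ C'·rad^{A'} = C'·(rad^Λ)^{1/2} ≤ R^{1/2}·R^{1/2} = R ≤ R^{1+δ}`, and a triple with `R < rad^Λ`
has `c ≤ R^{1+δ}` by hypothesis.  (The statement is kept on one line: it is the signature registered on
stmt-ABC-2161 for this sub-goal.) [folklore] -/
theorem sparseGoodScales_of_boundedQuality_of_windowed : (∃ A C : ℝ, ∀ a b c : ℕ, IsABCTriple a b c → (c : ℝ) ≤ C * ((rad a b c : ℕ) : ℝ) ^ A) → (∀ δ : ℝ, 0 < δ → ∀ Λ : ℝ, 1 < Λ → ∀ N : ℕ, ∃ R : ℕ, N ≤ R ∧ ∀ a b c : ℕ, IsABCTriple a b c → rad a b c ≤ R → (R : ℝ) < ((rad a b c : ℕ) : ℝ) ^ Λ → (c : ℝ) ≤ (R : ℝ) ^ (1 + δ)) → Summit.ABC.ABC.Theses.FeketeScales.SparseGoodScales := by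
  intro hB hW δ hδ N
  obtain ⟨A, C, hAC⟩ := hB
  set A' : ℝ := max A 1 with hA'
  set C' : ℝ := max C 1 with hC'
  have hA'1 : 1 ≤ A' := le_max_right _ _
  have hC'1 : 1 ≤ C' := le_max_right _ _
  have hC'0 : 0 ≤ C' := by linarith
  -- strengthened polynomial bound with `A' ≥ 1`, `C' ≥ 1`
  have hAC' : ∀ a b c : ℕ, IsABCTriple a b c → (c : ℝ) ≤ C' * ((rad a b c : ℕ) : ℝ) ^ A' := by
    intro a b c h
    have hr1 : (1 : ℝ) ≤ ((rad a b c : ℕ) : ℝ) := Literature.Barriers.ABC.one_le_rad_real a b c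
    have hpow : ((rad a b c : ℕ) : ℝ) ^ A ≤ ((rad a b c : ℕ) : ℝ) ^ A' :=
      Real.rpow_le_rpow_of_exponent_le hr1 (le_max_left _ _)
    have hpow0 : 0 ≤ ((rad a b c : ℕ) : ℝ) ^ A := Real.rpow_nonneg (by positivity) _
    calc (c : ℝ) ≤ C * ((rad a b c : ℕ) : ℝ) ^ A := hAC a b c h
      _ ≤ C' * ((rad a b c : ℕ) : ℝ) ^ A := mul_le_mul_of_nonneg_right (le_max_left _ _) hpow0
      _ ≤ C' * ((rad a b c : ℕ) : ℝ) ^ A' := mul_le_mul_of_nonneg_left hpow hC'0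
  -- window ratio `Λ = 2A'`
  set Λ : ℝ := 2 * A' with hΛ
  have hΛ1 : 1 < Λ := by linarith
  -- threshold `R ≥ C'^2`
  obtain ⟨M, hM⟩ := exists_nat_ge (C' ^ 2)
  obtain ⟨R, hRN, hR⟩ := hW δ hδ Λ hΛ1 (max (max N M) 1)
  refine ⟨R, le_trans (le_trans (le_max_left _ _) (le_max_left _ _)) hRN, ?_⟩
  intro a b c h hr
  have hR1nat : 1 ≤ R := le_trans (le_max_right _ _) hRN
  have hR1 : (1 : ℝ) ≤ (R : ℝ) := by exact_mod_cast hR1nat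
  have hRpos : (0 : ℝ) < R := by linarith
  have hMR : (M : ℝ) ≤ R := by
    exact_mod_cast le_trans (le_trans (le_max_right _ _) (le_max_left _ _)) hRN
  have hRC : C' ^ 2 ≤ (R : ℝ) := le_trans hM hMR
  by_cases hwin : (R : ℝ) < ((rad a b c : ℕ) : ℝ) ^ Λ
  · -- inside the window: the horizontal hypothesis
    exact hR a b c h hr hwin
  · -- below the window: the polynomial bound suffices
    have hwin' : ((rad a b c : ℕ) : ℝ) ^ Λ ≤ (R : ℝ) := not_lt.mp hwin
    have hr0 : (0 : ℝ) ≤ ((rad a b c : ℕ) : ℝ) := by positivity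
    have hradA : ((rad a b c : ℕ) : ℝ) ^ A' ≤ (R : ℝ) ^ (1 / 2 : ℝ) := by
      have hrew : ((rad a b c : ℕ) : ℝ) ^ A' = (((rad a b c : ℕ) : ℝ) ^ Λ) ^ (1 / 2 : ℝ) := by
        rw [← Real.rpow_mul hr0, hΛ]
        congr 1
        ring
      rw [hrew]
      exact Real.rpow_le_rpow (Real.rpow_nonneg hr0 _) hwin' (by norm_num)
    have hsqrt : C' ≤ (R : ℝ) ^ (1 / 2 : ℝ) := by
      calc C' = Real.sqrt (C' ^ 2) := by rw [Real.sqrt_sq hC'0]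
        _ ≤ Real.sqrt R := Real.sqrt_le_sqrt hRC
        _ = (R : ℝ) ^ (1 / 2 : ℝ) := Real.sqrt_eq_rpow _
    calc (c : ℝ) ≤ C' * ((rad a b c : ℕ) : ℝ) ^ A' := hAC' a b c h
      _ ≤ (R : ℝ) ^ (1 / 2 : ℝ) * (R : ℝ) ^ (1 / 2 : ℝ) :=
          mul_le_mul hsqrt hradA (Real.rpow_nonneg hr0 _) (Real.rpow_nonneg hRpos.le _)
      _ = (R : ℝ) ^ (1 : ℝ) := by
          rw [← Real.rpow_add hRpos]
          norm_num
      _ ≤ (R : ℝ) ^ (1 + δ) := Real.rpow_le_rpow_of_exponent_le hR1 (by linarith)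

/-- **The crux implies its windowed form** (drop the window hypothesis): `SparseGoodScales` →
windowed good scales, unconditionally. [folklore] -/
theorem sparseGoodScales_windowed_of_sparseGoodScales (h : SparseGoodScales) :
    ∀ δ : ℝ, 0 < δ → ∀ Λ : ℝ, 1 < Λ → ∀ N : ℕ, ∃ R : ℕ, N ≤ R ∧ ∀ a b c : ℕ,
      IsABCTriple a b c → rad a b c ≤ R → (R : ℝ) < ((rad a b c : ℕ) : ℝ) ^ Λ →
        (c : ℝ) ≤ (R : ℝ) ^ (1 + δ) := by
  intro δ hδ Λ _hΛ N
  obtain ⟨R, hRN, hR⟩ := h δ hδ N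
  exact ⟨R, hRN, fun a b c habc hr _ => hR a b c habc hr⟩

/-- **Under bounded quality the crux IS its windowed form**: given `c ≤ C·rad^A` for all abc
triples, `SparseGoodScales` is equivalent to windowed good scales (a statement with no heights
below the window `(R^{1/Λ}, R]`). [folklore] -/
theorem sparseGoodScales_iff_windowed_of_boundedQuality
    (hB : ∃ A C : ℝ, ∀ a b c : ℕ, IsABCTriple a b c → (c : ℝ) ≤ C * ((rad a b c : ℕ) : ℝ) ^ A) :
    SparseGoodScales ↔
      ∀ δ : ℝ, 0 < δ → ∀ Λ : ℝ, 1 < Λ → ∀ N : ℕ, ∃ R : ℕ, N ≤ R ∧ ∀ a b c : ℕ,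
        IsABCTriple a b c → rad a b c ≤ R → (R : ℝ) < ((rad a b c : ℕ) : ℝ) ^ Λ →
          (c : ℝ) ≤ (R : ℝ) ^ (1 + δ) :=
  ⟨sparseGoodScales_windowed_of_sparseGoodScales,
    sparseGoodScales_of_boundedQuality_of_windowed hB⟩

/-- **In-route supply of the vertical factor**: the sister crux `ScaleSubmultiplicativity`
(stmt-ABC-2160) gives bounded quality `∃ A C, c ≤ C·rad^A`, by the proved support item
`PolynomialAbcOfSubmult` (`polynomialAbcOfSubmult_proof`, stmt-ABC-2163) and the discharged
S-unit finiteness abc.S25 (`finite_setOf_isABCTriple_primeFactors_subset_holds`, Mahler 1933).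
[folklore] -/
theorem sparseGoodScales_boundedQuality_of_scaleSubmultiplicativity
    (hS : ScaleSubmultiplicativity) :
    ∃ A C : ℝ, ∀ a b c : ℕ, IsABCTriple a b c → (c : ℝ) ≤ C * ((rad a b c : ℕ) : ℝ) ^ A :=
  polynomialAbcOfSubmult_proof hS finite_setOf_isABCTriple_primeFactors_subset_holds

/-- **Inside the route the crux is height-free**: under the sister crux
`ScaleSubmultiplicativity` (stmt-ABC-2160), `SparseGoodScales` is equivalent to windowed good
scales. [folklore] -/
theorem sparseGoodScales_iff_windowed_of_scaleSubmultiplicativity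
    (hS : ScaleSubmultiplicativity) :
    SparseGoodScales ↔
      ∀ δ : ℝ, 0 < δ → ∀ Λ : ℝ, 1 < Λ → ∀ N : ℕ, ∃ R : ℕ, N ≤ R ∧ ∀ a b c : ℕ,
        IsABCTriple a b c → rad a b c ≤ R → (R : ℝ) < ((rad a b c : ℕ) : ℝ) ^ Λ →
          (c : ℝ) ≤ (R : ℝ) ^ (1 + δ) :=
  sparseGoodScales_iff_windowed_of_boundedQuality
    (sparseGoodScales_boundedQuality_of_scaleSubmultiplicativity hS)

/-- **Calibration: the abc conjecture implies the crux** (every large scale is good).  From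
`ABC` with exponent `δ/2` and constant `C`, every scale `R ≥ C^{2/δ}` satisfies
`c < C·rad^{1+δ/2} ≤ C·R^{1+δ/2} ≤ R^{δ/2}·R^{1+δ/2} = R^{1+δ}` for every abc triple of radical
`≤ R`. [folklore] -/
theorem sparseGoodScales_of_abc : _root_.ABC → SparseGoodScales := by
  intro habc δ hδ N
  have hδ2 : 0 < δ / 2 := by linarith
  obtain ⟨C, hC, hABC⟩ := (_root_.ABC_iff.mp habc) (δ / 2) hδ2
  -- threshold `R ≥ C^{2/δ}` (and `R ≥ 1`)
  obtain ⟨M, hM⟩ := exists_nat_ge (C ^ (2 / δ))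
  refine ⟨max (max N M) 1, le_trans (le_max_left _ _) (le_max_left _ _), ?_⟩
  intro a b c h hr
  set R : ℕ := max (max N M) 1 with hRdef
  have hR1 : (1 : ℝ) ≤ (R : ℝ) := by exact_mod_cast (le_max_right _ _ : 1 ≤ R)
  have hRpos : (0 : ℝ) < R := by linarith
  have hMR : (M : ℝ) ≤ R := by exact_mod_cast le_trans (le_max_right _ _) (le_max_left _ _)
  have hCR : C ^ (2 / δ) ≤ (R : ℝ) := le_trans hM hMR
  -- `C ≤ R^{δ/2}`
  have hC_le : C ≤ (R : ℝ) ^ (δ / 2) := by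
    have h1 : (C ^ (2 / δ)) ^ (δ / 2) ≤ (R : ℝ) ^ (δ / 2) :=
      Real.rpow_le_rpow (Real.rpow_nonneg hC.le _) hCR hδ2.le
    have h2 : (C ^ (2 / δ)) ^ (δ / 2) = C := by
      rw [← Real.rpow_mul hC.le]
      have : 2 / δ * (δ / 2) = 1 := by field_simp
      rw [this, Real.rpow_one]
    rw [h2] at h1
    exact h1
  have hr0 : (0 : ℝ) ≤ ((rad a b c : ℕ) : ℝ) := by positivity
  have hrR : ((rad a b c : ℕ) : ℝ) ≤ (R : ℝ) := by exact_mod_cast hr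
  have hpow : ((rad a b c : ℕ) : ℝ) ^ (1 + δ / 2) ≤ (R : ℝ) ^ (1 + δ / 2) :=
    Real.rpow_le_rpow hr0 hrR (by linarith)
  calc (c : ℝ) ≤ C * ((rad a b c : ℕ) : ℝ) ^ (1 + δ / 2) := (hABC a b c h).le
    _ ≤ C * (R : ℝ) ^ (1 + δ / 2) := mul_le_mul_of_nonneg_left hpow hC.le
    _ ≤ (R : ℝ) ^ (δ / 2) * (R : ℝ) ^ (1 + δ / 2) :=
        mul_le_mul_of_nonneg_right hC_le (Real.rpow_nonneg hRpos.le _)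
    _ = (R : ℝ) ^ (1 + δ) := by
        rw [← Real.rpow_add hRpos]
        congr 1
        ring

/-! ### Appendix (cycle 1 of line `Sketch`): where the two stubs sit in the item graph

* the VERTICAL stub is, verbatim, the open crux `PolynomialABC` of route `FermatTwistHeights`
  (item stmt-ABC-1724) — `sparseGoodScales_boundedQuality_iff_polynomialABC` (`Iff.rfl`);
* INSIDE this route (under the sister crux `ScaleSubmultiplicativity`, stmt-ABC-2160) the crux
  `SparseGoodScales` and its windowed form are both equivalent to the summit `ABC` — the route's
  Assembly gives `→`, the calibration `sparseGoodScales_of_abc` gives `←`; so, given stmt-ABC-2160,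
  a proof of the HORIZONTAL stub is a proof of the abc conjecture (this is the kernel-checked form of
  `Cruxes/SparseGoodScales/BarrierNotes-r1-k2.md`, N6). -/

/-- **The vertical stub is an existing crux of another route.**  Bounded quality
`∃ A C, ∀ abc triples, c ≤ C·rad^A` is, verbatim, the open crux
`Summit.ABC.ABC.Theses.FermatTwistHeights.PolynomialABC` (item stmt-ABC-1724, "polynomial abc").
[folklore] -/
theorem sparseGoodScales_boundedQuality_iff_polynomialABC :
    (∃ A C : ℝ, ∀ a b c : ℕ, IsABCTriple a b c → (c : ℝ) ≤ C * ((rad a b c : ℕ) : ℝ) ^ A) ↔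
      Summit.ABC.ABC.Theses.FermatTwistHeights.PolynomialABC :=
  Iff.rfl

/-- **Under polynomial abc the crux is height-free**: `PolynomialABC` (stmt-ABC-1724) makes
`SparseGoodScales` equivalent to windowed good scales. [folklore] -/
theorem sparseGoodScales_iff_windowed_of_polynomialABC
    (hP : Summit.ABC.ABC.Theses.FermatTwistHeights.PolynomialABC) :
    SparseGoodScales ↔
      ∀ δ : ℝ, 0 < δ → ∀ Λ : ℝ, 1 < Λ → ∀ N : ℕ, ∃ R : ℕ, N ≤ R ∧ ∀ a b c : ℕ,
        IsABCTriple a b c → rad a b c ≤ R → (R : ℝ) < ((rad a b c : ℕ) : ℝ) ^ Λ →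
          (c : ℝ) ≤ (R : ℝ) ^ (1 + δ) :=
  sparseGoodScales_iff_windowed_of_boundedQuality
    (sparseGoodScales_boundedQuality_iff_polynomialABC.mpr hP)

/-- **Inside the route the crux is summit-equivalent.**  Under the sister crux
`ScaleSubmultiplicativity` (stmt-ABC-2160): `SparseGoodScales ↔ ABC` — `→` is the route's Assembly
(`feketeScales_assembly_proof`, the Fekete-type upgrade from sparse good scales to all scales),
`←` is the calibration `sparseGoodScales_of_abc`.  So, given stmt-ABC-2160, stmt-ABC-2161 carries
the full weight of the summit. [folklore] -/
theorem sparseGoodScales_iff_abc_of_scaleSubmultiplicativity (hS : ScaleSubmultiplicativity) :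
    SparseGoodScales ↔ _root_.ABC :=
  ⟨fun h => feketeScales_assembly_proof hS h, sparseGoodScales_of_abc⟩

/-- **Inside the route the horizontal stub is summit-equivalent.**  Under
`ScaleSubmultiplicativity` (stmt-ABC-2160), windowed good scales `↔ ABC` (compose
`sparseGoodScales_iff_windowed_of_scaleSubmultiplicativity` with
`sparseGoodScales_iff_abc_of_scaleSubmultiplicativity`). [folklore] -/
theorem sparseGoodScales_windowed_iff_abc_of_scaleSubmultiplicativity
    (hS : ScaleSubmultiplicativity) :
    (∀ δ : ℝ, 0 < δ → ∀ Λ : ℝ, 1 < Λ → ∀ N : ℕ, ∃ R : ℕ, N ≤ R ∧ ∀ a b c : ℕ,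
        IsABCTriple a b c → rad a b c ≤ R → (R : ℝ) < ((rad a b c : ℕ) : ℝ) ^ Λ →
          (c : ℝ) ≤ (R : ℝ) ^ (1 + δ)) ↔ _root_.ABC :=
  (sparseGoodScales_iff_windowed_of_scaleSubmultiplicativity hS).symm.trans
    (sparseGoodScales_iff_abc_of_scaleSubmultiplicativity hS)

/-- **Calibration of the horizontal stub**: `ABC` implies windowed good scales (through the
crux). [folklore] -/
theorem sparseGoodScales_windowed_of_abc (habc : _root_.ABC) :
    ∀ δ : ℝ, 0 < δ → ∀ Λ : ℝ, 1 < Λ → ∀ N : ℕ, ∃ R : ℕ, N ≤ R ∧ ∀ a b c : ℕ,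
      IsABCTriple a b c → rad a b c ≤ R → (R : ℝ) < ((rad a b c : ℕ) : ℝ) ^ Λ →
        (c : ℝ) ≤ (R : ℝ) ^ (1 + δ) :=
  sparseGoodScales_windowed_of_sparseGoodScales (sparseGoodScales_of_abc habc)

end Summit.ABC.ABC.Theorems
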